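/-
Copyright (c) 2026 the pub-hodgecm-mathlib formalisation cell (harness21).  Prover seat hodgecm-mathlib-K2E5-p16 (g6), Track B «K2-LIT»,
#184♮ = hLiu418 = `stmt-HodgeConjecture-24832`; A7-val ROAD (σ) «NULL-CONE MULTIPLICITY ONE» (K2Liu-p09 (g6) paper-first memo
`REPORT-FIRST-A7val-PaperFirst` 0ec4b1215f8a4fcc §3 V4; K2E5-plan (g7) fan-out 11:19:22Z «V4 → K2E5-p16»), file V4 `K2LiuHomogeneousFunctionalLine`:
the SEMI-invariant linear functionals on the test functions of ONE orbit form a space of dimension ≤ 1 — ★ «COINV-1»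
(`Literature.MeasureTheory.Group.InvariantFunctionalLocallyConstant`) made MEASURE-FREE and with a character.  THEOREMS ONLY (no `def`, no `instance`, no
notation, no named-fact hypothesis, no `sorry`; no Haar measure, no modular function).
-/
import Literature.MeasureTheory.Group.InvariantFunctionalLocallyConstant   -- ★ LH4-p02: «COINV-1» (cells, transport, the χ = 1 case with a measure)
import HarnessLib

/-!
# Crux `HLiu418`, A7-val road (σ), V4: semi-invariant functionals on the test functions of a homogeneous `ℓ`-space form a line

Cell `hodgecm-mathlib`, crux item hLiu418 = `stmt-HodgeConjecture-24832` (helper lane `--supports`, count-neutral).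

THE STATEMENT.  `G` a totally disconnected topological group with a compact open subgroup `K₀`, acting continuously and TRANSITIVELY on a topological
space `X` with OPEN orbit maps; `χ : G →* ℂ` a multiplicative character with `χ = 1` on `K₀`; a `ℂ`-linear functional `T` on `X → ℂ` is
`χ`-SEMI-INVARIANT if `T (y ↦ F (g • y)) = χ g · T F` for every test function `F ∈ S(X)` (locally constant, compactly supported) and every `g`.
THEN for every `F ∈ S(X)` there is a scalar `r_F`, INDEPENDENT OF `T`, with `T F = r_F · T (1_{K₀•x₀})` for every semi-invariant `T`
(`exists_forall_apply_eq_mul_base`); hence any two semi-invariant functionals satisfy `T₁ F · T₂(1_{K₀•x₀}) = T₂ F · T₁(1_{K₀•x₀})`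
(`apply_mul_apply_base_comm`), a semi-invariant `T` with `T (1_{K₀•x₀}) = 0` vanishes on `S(X)` (`eq_zero_of_apply_base_eq_zero`), and if `T₁ ≢ 0` on
`S(X)` then `T₂ = c · T₁` on `S(X)` (`exists_forall_apply_eq_const_mul`) — «`dim Hom_G(S(X), χ) ≤ 1`».
THE PROOF (★ COINV-1's cells with the invariant measure replaced by a second functional).  §1 translates: `T (1_{g•S}) = χ(g⁻¹)·T(1_S)`; §2 the
REFINEMENT COUNT `∃ k ≥ 1, ∀ T, T(1_{M•x}) = k·T(1_{N•x})` for `N ⊴ M` open in the compact open `M` with `χ|_M = 1` (★ NORMAL REFINEMENT), and the RATIO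
`∃ q > 0, ∀ T, T(1_{M₁•x}) = q·T(1_{M₂•x})` for two compact open subgroups (three refinements, ★ `exists_isOpen_subgroup_le_subset_conj_mem`); §3 TRANSPORT
`K₀ • (g•x₀) = g • (K₀^g • x₀)` (★) with `χ|_{K₀^g} = 1` because `χ` is a homomorphism; §4 the cell decomposition of `F ∈ S(X)` at a level `N ≤ K₀` (★).
Consumer: V5 `K2LiuNullConeMultiplicityOne` (the `I_v(−½)`-law functionals on `C_c^∞(𝒩₁)`; `G = GL₂(E_v) × U(V′_v)`, `χ` trivial on a congruence level).
References: [BernsteinZelevinsky1976, §1.18–1.21]; [Rallis1984]; [KudlaRallis1990, §2]; [KudlaSweet1997, §2].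
HONEST LABEL: HC_CM is proved only modulo the 7 printed citations (2 remaining named inputs: hLiu418 = stmt-HodgeConjecture-24832,
h413 = stmt-HodgeConjecture-24833) until rung 0 closes; count-neutral helper, closes no socket.
-/

set_option autoImplicit false
set_option linter.dupNamespace false

noncomputable section

open Set Filter Topology MulAction Literature.Topology Literature.MeasureTheory.Group
open scoped Pointwise

namespace Summit.HodgeConjecture.HodgeConjecture.Cruxes.HLiu418.K2LiuHomogeneousFunctionalLine

/-! ## §1  Translates of cells under a semi-invariant functional -/

section Translate

variable {G : Type*} [Group G] {X : Type*} [TopologicalSpace X] [MulAction G X]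

/-- **A `χ`-semi-invariant functional on a translate of a compact open cell**: `T (1_{g•S}) = χ(g⁻¹) · T (1_S)`.
[BernsteinZelevinsky1976, §1.18] -/
theorem apply_indicator_smul_set_eq_mul {S : Set X} (hSo : IsOpen S) (hSc : IsCompact S) (hScl : IsClosed S) (χ : G →* ℂ)
    (T : (X → ℂ) →ₗ[ℂ] ℂ) (hT : ∀ F : X → ℂ, IsLocallyConstant F → HasCompactSupport F → ∀ g : G, T (fun x => F (g • x)) = χ g * T F)
    (g : G) (a : ℂ) : T ((g • S).indicator fun _ => a) = χ g⁻¹ * T (S.indicator fun _ => a) := by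
  rw [indicator_smul_set_const]
  exact hT _ (Literature.GroupTheory.isLocallyConstant_indicator_const_of_isClopen ⟨hScl, hSo⟩ a)
    (hasCompactSupport_indicator_const_of_isCompact hSc hScl a) g⁻¹

/-- A character trivial on `M` is trivial on inverses of elements of `M`. [folklore] -/
theorem char_inv_eq_one {M : Subgroup G} (χ : G →* ℂ) (hχ : ∀ m ∈ M, χ m = 1) {m : G} (hm : m ∈ M) : χ m⁻¹ = 1 :=
  hχ m⁻¹ (M.inv_mem hm)

/-- A character trivial on `K₀` is trivial on every conjugate `K₀^g = g⁻¹ K₀ g`. [folklore] -/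
theorem char_eq_one_of_mem_comap_conj {K₀ : Subgroup G} (χ : G →* ℂ) (hχ : ∀ k ∈ K₀, χ k = 1) (g : G) :
    ∀ k ∈ K₀.comap (MulAut.conj g).toMonoidHom, χ k = 1 := by
  intro k hk
  rw [mem_comap_conj_iff] at hk
  have h := hχ _ hk
  rw [map_mul, map_mul] at h
  have hg : χ g * χ g⁻¹ = 1 := by rw [← map_mul, mul_inv_cancel, map_one]
  calc χ k = χ g * χ k * χ g⁻¹ * 1 := by rw [mul_one, mul_right_comm, hg, one_mul]
    _ = 1 := by rw [h, one_mul]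

end Translate

/-! ## §2  The refinement count and the ratio of two cells at one point (shared by ALL semi-invariant functionals) -/

section Count

variable {G : Type*} [Group G] [TopologicalSpace G] [IsTopologicalGroup G] {X : Type*} [TopologicalSpace X] [MulAction G X]

/-- **REFINEMENT COUNT** (uniform in the functional).  `M` a compact open subgroup with `χ|_M = 1`, `N ≤ M` open and normalised by `M`, orbit maps
continuous and open: with `k ≥ 1` the number of `N`-cells in `M • x`, EVERY `χ`-semi-invariant functional satisfies `T(1_{M•x}) = k · T(1_{N•x})`.
[BernsteinZelevinsky1976, §1.18] -/
theorem exists_pos_forall_apply_indicator_orbit_eq_natCast_mul (hcont : ∀ x : X, Continuous fun g : G => g • x)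
    (hopen : ∀ x : X, IsOpenMap fun g : G => g • x) {M N : Subgroup G} (hMc : IsCompact (M : Set G))
    (hNo : IsOpen (N : Set G)) (hNM : N ≤ M) (hnorm : ∀ m ∈ M, ∀ n ∈ N, m * n * m⁻¹ ∈ N) (x : X) (χ : G →* ℂ)
    (hχ : ∀ m ∈ M, χ m = 1) :
    ∃ k : ℕ, 0 < k ∧ ∀ (T : (X → ℂ) →ₗ[ℂ] ℂ),
      (∀ F : X → ℂ, IsLocallyConstant F → HasCompactSupport F → ∀ g : G, T (fun y => F (g • y)) = χ g * T F) →
        T ((orbit M x).indicator fun _ => (1 : ℂ)) = (k : ℂ) * T ((orbit N x).indicator fun _ => (1 : ℂ)) := by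
  classical
  obtain ⟨A, hxA, htrans, hdisj, hU⟩ :=
    exists_finset_orbit_eq_biUnion_smul_orbit hcont hMc (isOpen_orbit_subgroup hopen N hNo) hNM hnorm x
  have hNc : IsCompact (N : Set G) := hMc.of_isClosed_subset (N.isClosed_of_isOpen hNo) (SetLike.coe_subset_coe.2 hNM)
  have hcell_o : IsOpen (orbit N x) := isOpen_orbit_subgroup hopen N hNo x
  have hcell_c : IsCompact (orbit N x) := isCompact_orbit_subgroup hcont N hNc x
  have hcell_cl : IsClosed (orbit N x) := isClosed_orbit_subgroup hopen N hNo x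
  refine ⟨A.card, Finset.card_pos.2 ⟨_, hxA⟩, fun T hT => ?_⟩
  have hind : (orbit M x).indicator (fun _ => (1 : ℂ)) = ∑ ω ∈ A, (orbitRel.Quotient.orbit ω).indicator fun _ => (1 : ℂ) := by
    rw [hU, Finset.indicator_biUnion A _ hdisj, ← Finset.sum_fn]
  rw [hind, _root_.map_sum]
  have hterm : ∀ ω ∈ A, T ((orbitRel.Quotient.orbit ω).indicator fun _ => (1 : ℂ)) = T ((orbit N x).indicator fun _ => (1 : ℂ)) := by
    intro ω hω
    obtain ⟨m, hm, hmω⟩ := htrans ω hω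
    rw [hmω, apply_indicator_smul_set_eq_mul hcell_o hcell_c hcell_cl χ T hT m 1, char_inv_eq_one χ hχ hm, one_mul]
  rw [Finset.sum_congr rfl hterm, Finset.sum_const, nsmul_eq_mul]

/-- **THE RATIO OF TWO CELLS AT ONE POINT IS A POSITIVE RATIONAL, THE SAME FOR ALL SEMI-INVARIANT FUNCTIONALS.**  For compact open subgroups `M₁, M₂` of a
totally disconnected group with `χ = 1` on both: `∃ q > 0, ∀ T, T(1_{M₁•x}) = q · T(1_{M₂•x})` — three refinements `M₁ ⊵ N₁ ⊵ N₂ ⊴ M₂`.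
[BernsteinZelevinsky1976, §1.18] -/
theorem exists_pos_forall_apply_indicator_orbit_eq_mul [TotallyDisconnectedSpace G] (hcont : ∀ x : X, Continuous fun g : G => g • x)
    (hopen : ∀ x : X, IsOpenMap fun g : G => g • x) {M₁ M₂ : Subgroup G} (h₁o : IsOpen (M₁ : Set G)) (h₁c : IsCompact (M₁ : Set G))
    (h₂o : IsOpen (M₂ : Set G)) (h₂c : IsCompact (M₂ : Set G)) (x : X) (χ : G →* ℂ) (hχ₁ : ∀ m ∈ M₁, χ m = 1) (hχ₂ : ∀ m ∈ M₂, χ m = 1) :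
    ∃ q : ℝ, 0 < q ∧ ∀ (T : (X → ℂ) →ₗ[ℂ] ℂ),
      (∀ F : X → ℂ, IsLocallyConstant F → HasCompactSupport F → ∀ g : G, T (fun y => F (g • y)) = χ g * T F) →
        T ((orbit M₁ x).indicator fun _ => (1 : ℂ)) = (q : ℂ) * T ((orbit M₂ x).indicator fun _ => (1 : ℂ)) := by
  obtain ⟨N₁, hN₁o, hN₁M₁, hN₁M₂, hN₁n⟩ :=
    Literature.Topology.Algebra.exists_isOpen_subgroup_le_subset_conj_mem M₁ h₁o h₁c (h₂o.mem_nhds M₂.one_mem)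
  obtain ⟨N₂, hN₂o, hN₂M₂, hN₂N₁, hN₂n⟩ :=
    Literature.Topology.Algebra.exists_isOpen_subgroup_le_subset_conj_mem M₂ h₂o h₂c (hN₁o.mem_nhds N₁.one_mem)
  have hN₁c : IsCompact (N₁ : Set G) := h₁c.of_isClosed_subset (N₁.isClosed_of_isOpen hN₁o) (SetLike.coe_subset_coe.2 hN₁M₁)
  have hN₂N₁' : N₂ ≤ N₁ := SetLike.coe_subset_coe.1 hN₂N₁
  have hN₂n' : ∀ m ∈ N₁, ∀ n ∈ N₂, m * n * m⁻¹ ∈ N₂ := fun m hm n hn => hN₂n m (hN₁M₂ hm) n hn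
  have hχN₁ : ∀ m ∈ N₁, χ m = 1 := fun m hm => hχ₁ m (hN₁M₁ hm)
  obtain ⟨a, ha, hTa⟩ := exists_pos_forall_apply_indicator_orbit_eq_natCast_mul hcont hopen h₁c hN₁o hN₁M₁ hN₁n x χ hχ₁
  obtain ⟨b, hb, hTb⟩ := exists_pos_forall_apply_indicator_orbit_eq_natCast_mul hcont hopen hN₁c hN₂o hN₂N₁' hN₂n' x χ hχN₁
  obtain ⟨c, hc, hTc⟩ := exists_pos_forall_apply_indicator_orbit_eq_natCast_mul hcont hopen h₂c hN₂o hN₂M₂ hN₂n x χ hχ₂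
  refine ⟨(a : ℝ) * b / c, by positivity, fun T hT => ?_⟩
  have hc0 : (c : ℂ) ≠ 0 := by exact_mod_cast hc.ne'
  rw [hTa T hT, hTb T hT]
  have h3 := hTc T hT
  -- `T(M₂) = c·T(N₂)` ⇒ `T(N₂) = T(M₂)∕c`
  have hN₂ : T ((orbit N₂ x).indicator fun _ => (1 : ℂ)) = (c : ℂ)⁻¹ * T ((orbit M₂ x).indicator fun _ => (1 : ℂ)) := by
    rw [h3, ← mul_assoc, inv_mul_cancel₀ hc0, one_mul]
  rw [hN₂]
  push_cast
  field_simp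

end Count

/-! ## §3  Transport to the base point and the value of every cell -/

section Main

variable {G : Type*} [Group G] [TopologicalSpace G] [IsTopologicalGroup G] [TotallyDisconnectedSpace G]
  {X : Type*} [TopologicalSpace X] [MulAction G X] [ContinuousSMul G X]

/-- **EVERY CELL IS A FIXED MULTIPLE OF THE BASE CELL, uniformly in the functional.**  For a compact open subgroup `N` with `χ|_N = 1` and any point `y` of the
(single) orbit: `∃ r, ∀ T semi-invariant, T(1_{N•y}) = r · T(1_{K₀•x₀})` (`r = q₁ · χ(g⁻¹) · q₂` along `y = g • x₀`, `K₀ • (g•x₀) = g • (K₀^g • x₀)`).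
[BernsteinZelevinsky1976, §1.18; KudlaRallis1990, §2] -/
theorem exists_forall_apply_indicator_orbit_eq_mul_base (K₀ : Subgroup G) (hK₀o : IsOpen (K₀ : Set G)) (hK₀c : IsCompact (K₀ : Set G))
    (hopen : ∀ x : X, IsOpenMap fun g : G => g • x) [IsPretransitive G X] (χ : G →* ℂ) (hχ : ∀ k ∈ K₀, χ k = 1)
    (x₀ : X) {N : Subgroup G} (hNo : IsOpen (N : Set G)) (hNc : IsCompact (N : Set G)) (hχN : ∀ n ∈ N, χ n = 1) (y : X) :
    ∃ r : ℂ, ∀ (T : (X → ℂ) →ₗ[ℂ] ℂ),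
      (∀ F : X → ℂ, IsLocallyConstant F → HasCompactSupport F → ∀ g : G, T (fun z => F (g • z)) = χ g * T F) →
        T ((orbit N y).indicator fun _ => (1 : ℂ)) = r * T ((orbit K₀ x₀).indicator fun _ => (1 : ℂ)) := by
  have hcont : ∀ x : X, Continuous fun g : G => g • x := fun x => continuous_id.smul continuous_const
  obtain ⟨g, rfl⟩ := exists_smul_eq G x₀ y
  -- the conjugate `K' = g⁻¹ K₀ g`
  have hK'o := isOpen_coe_comap_conj K₀ hK₀o g
  have hK'c := isCompact_coe_comap_conj K₀ hK₀c g
  set K' : Subgroup G := K₀.comap (MulAut.conj g).toMonoidHom with hK'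
  have hχK' : ∀ k ∈ K', χ k = 1 := char_eq_one_of_mem_comap_conj χ hχ g
  -- (1) ratio at `g • x₀` between `N` and `K₀`; (3) ratio at `x₀` between `K'` and `K₀`
  obtain ⟨q₁, -, h1⟩ := exists_pos_forall_apply_indicator_orbit_eq_mul hcont hopen hNo hNc hK₀o hK₀c (g • x₀) χ hχN hχ
  obtain ⟨q₂, -, h3⟩ := exists_pos_forall_apply_indicator_orbit_eq_mul hcont hopen hK'o hK'c hK₀o hK₀c x₀ χ hχK' hχ
  refine ⟨(q₁ : ℂ) * χ g⁻¹ * q₂, fun T hT => ?_⟩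
  -- (2) transport `K₀ • (g • x₀) = g • (K' • x₀)`
  have h2 : T ((orbit K₀ (g • x₀)).indicator fun _ => (1 : ℂ)) = χ g⁻¹ * T ((orbit K' x₀).indicator fun _ => (1 : ℂ)) := by
    rw [orbit_smul_eq_smul_orbit_comap_conj]
    exact apply_indicator_smul_set_eq_mul (isOpen_orbit_subgroup hopen K' hK'o x₀) (isCompact_orbit_subgroup hcont K' hK'c x₀)
      (isClosed_orbit_subgroup hopen K' hK'o x₀) χ T hT g 1
  rw [h1 T hT, h2, h3 T hT]
  ring

/-- **EVERY TEST FUNCTION IS WORTH A FIXED MULTIPLE OF THE BASE CELL, uniformly in the functional**: for `F ∈ S(X)`,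
`∃ r_F, ∀ T semi-invariant, T F = r_F · T(1_{K₀•x₀})` (a level `N ≤ K₀` fixing `F`, ★ cell decomposition, §3 cell values).
[BernsteinZelevinsky1976, §1.18] -/
theorem exists_forall_apply_eq_mul_base (K₀ : Subgroup G) (hK₀o : IsOpen (K₀ : Set G)) (hK₀c : IsCompact (K₀ : Set G))
    (hopen : ∀ x : X, IsOpenMap fun g : G => g • x) [IsPretransitive G X] (χ : G →* ℂ) (hχ : ∀ k ∈ K₀, χ k = 1) (x₀ : X)
    {F : X → ℂ} (hF : IsLocallyConstant F) (hFs : HasCompactSupport F) :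
    ∃ r : ℂ, ∀ (T : (X → ℂ) →ₗ[ℂ] ℂ),
      (∀ F' : X → ℂ, IsLocallyConstant F' → HasCompactSupport F' → ∀ g : G, T (fun z => F' (g • z)) = χ g * T F') →
        T F = r * T ((orbit K₀ x₀).indicator fun _ => (1 : ℂ)) := by
  classical
  -- a level: an open subgroup `N ≤ K₀` fixing `F`
  obtain ⟨N, hNo, hNK₀, hFN⟩ : ∃ N : Subgroup G, IsOpen (N : Set G) ∧ N ≤ K₀ ∧ ∀ x : X, ∀ n ∈ (N : Set G), F (n • x) = F x := by
    have hbasis : ∀ V ∈ 𝓝 (1 : G), ∃ N : {N : Subgroup G // IsOpen (N : Set G) ∧ N ≤ K₀}, ((N.1 : Subgroup G) : Set G) ⊆ V := by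
      intro V hV
      obtain ⟨N, hNo, hNK₀, hNV, -⟩ := Literature.Topology.Algebra.exists_isOpen_subgroup_le_subset_conj_mem K₀ hK₀o hK₀c hV
      exact ⟨⟨N, hNo, hNK₀⟩, hNV⟩
    obtain ⟨⟨N, hNo, hNK₀⟩, hN⟩ := exists_forall_smul_eq_of_hasCompactSupport_of_basis
      (K := fun N : {N : Subgroup G // IsOpen (N : Set G) ∧ N ≤ K₀} => ((N.1 : Subgroup G) : Set G)) hbasis hF hFs
    exact ⟨N, hNo, hNK₀, hN⟩
  have hNc : IsCompact (N : Set G) := hK₀c.of_isClosed_subset (N.isClosed_of_isOpen hNo) (SetLike.coe_subset_coe.2 hNK₀)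
  have hχN : ∀ n ∈ N, χ n = 1 := fun n hn => hχ n (hNK₀ hn)
  have hNorb : ∀ x : X, IsOpen (orbit N x) := isOpen_orbit_subgroup hopen N hNo
  -- the cell decomposition of `F`
  obtain ⟨A, -, hFA⟩ := exists_eq_finset_sum_indicator_orbit_of_forall_smul_eq N hNorb hFs (fun n hn x => hFN x n hn)
  have hFA' : F = ∑ ω ∈ A, (orbitRel.Quotient.orbit ω).indicator fun _ => F ω.out := by
    rw [Finset.sum_fn]; exact hFA
  -- each cell has a `T`-independent coefficient
  have hcell : ∀ ω : orbitRel.Quotient N X, ∃ r : ℂ, ∀ (T : (X → ℂ) →ₗ[ℂ] ℂ),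
      (∀ F' : X → ℂ, IsLocallyConstant F' → HasCompactSupport F' → ∀ g : G, T (fun z => F' (g • z)) = χ g * T F') →
        T ((orbitRel.Quotient.orbit ω).indicator fun _ => F ω.out) = r * T ((orbit K₀ x₀).indicator fun _ => (1 : ℂ)) := by
    intro ω
    obtain ⟨r, hr⟩ := exists_forall_apply_indicator_orbit_eq_mul_base K₀ hK₀o hK₀c hopen χ hχ x₀ hNo hNc hχN ω.out
    refine ⟨F ω.out * r, fun T hT => ?_⟩
    rw [orbitRel.Quotient.orbit_eq_orbit_out ω Quotient.out_eq']
    have hind : (orbit N ω.out).indicator (fun _ => F ω.out) = F ω.out • (orbit N ω.out).indicator fun _ => (1 : ℂ) := by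
      funext x
      by_cases hx : x ∈ orbit N ω.out
      · simp only [Set.indicator_of_mem hx, Pi.smul_apply, smul_eq_mul, mul_one]
      · simp only [Set.indicator_of_notMem hx, Pi.smul_apply, smul_eq_mul, mul_zero]
    rw [hind, map_smul, hr T hT, smul_eq_mul, mul_assoc]
  choose r hr using hcell
  refine ⟨∑ ω ∈ A, r ω, fun T hT => ?_⟩
  rw [hFA', _root_.map_sum, Finset.sum_mul]
  exact Finset.sum_congr rfl fun ω _ => hr ω T hT

/-- **PROPORTIONALITY** («`dim ≤ 1`», symmetric form): for any two `χ`-semi-invariant functionals and every `F ∈ S(X)`,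
`T₁ F · T₂(1_{K₀•x₀}) = T₂ F · T₁(1_{K₀•x₀})`. [BernsteinZelevinsky1976, §1.18; KudlaSweet1997, §2] -/
theorem apply_mul_apply_base_comm (K₀ : Subgroup G) (hK₀o : IsOpen (K₀ : Set G)) (hK₀c : IsCompact (K₀ : Set G))
    (hopen : ∀ x : X, IsOpenMap fun g : G => g • x) [IsPretransitive G X] (χ : G →* ℂ) (hχ : ∀ k ∈ K₀, χ k = 1) (x₀ : X)
    (T₁ T₂ : (X → ℂ) →ₗ[ℂ] ℂ)
    (hT₁ : ∀ F : X → ℂ, IsLocallyConstant F → HasCompactSupport F → ∀ g : G, T₁ (fun z => F (g • z)) = χ g * T₁ F)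
    (hT₂ : ∀ F : X → ℂ, IsLocallyConstant F → HasCompactSupport F → ∀ g : G, T₂ (fun z => F (g • z)) = χ g * T₂ F)
    {F : X → ℂ} (hF : IsLocallyConstant F) (hFs : HasCompactSupport F) :
    T₁ F * T₂ ((orbit K₀ x₀).indicator fun _ => (1 : ℂ)) = T₂ F * T₁ ((orbit K₀ x₀).indicator fun _ => (1 : ℂ)) := by
  obtain ⟨r, hr⟩ := exists_forall_apply_eq_mul_base K₀ hK₀o hK₀c hopen χ hχ x₀ hF hFs
  rw [hr T₁ hT₁, hr T₂ hT₂]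
  ring

/-- **A semi-invariant functional vanishing on the base cell vanishes on `S(X)`.** [BernsteinZelevinsky1976, §1.18] -/
theorem eq_zero_of_apply_base_eq_zero (K₀ : Subgroup G) (hK₀o : IsOpen (K₀ : Set G)) (hK₀c : IsCompact (K₀ : Set G))
    (hopen : ∀ x : X, IsOpenMap fun g : G => g • x) [IsPretransitive G X] (χ : G →* ℂ) (hχ : ∀ k ∈ K₀, χ k = 1) (x₀ : X)
    (T : (X → ℂ) →ₗ[ℂ] ℂ) (hT : ∀ F : X → ℂ, IsLocallyConstant F → HasCompactSupport F → ∀ g : G, T (fun z => F (g • z)) = χ g * T F)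
    (h0 : T ((orbit K₀ x₀).indicator fun _ => (1 : ℂ)) = 0) {F : X → ℂ} (hF : IsLocallyConstant F) (hFs : HasCompactSupport F) :
    T F = 0 := by
  obtain ⟨r, hr⟩ := exists_forall_apply_eq_mul_base K₀ hK₀o hK₀c hopen χ hχ x₀ hF hFs
  rw [hr T hT, h0, mul_zero]

/-- **THE SEMI-INVARIANT FUNCTIONALS ON `S(X)` OF ONE ORBIT FORM A LINE** («multiplicity ≤ 1»): `G` a totally disconnected topological group with a compact
open subgroup `K₀`, acting continuously and transitively on `X` with open orbit maps, `χ : G →* ℂ` trivial on `K₀`; if `T₁, T₂` are `χ`-semi-invariant on the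
locally constant compactly supported functions and `T₁ F₀ ≠ 0` for one such `F₀`, then `∃ c, ∀ F ∈ S(X), T₂ F = c · T₁ F`.  No Haar measure, no modular
function: the refinement counts are shared by all semi-invariant functionals. [BernsteinZelevinsky1976, §1.18–1.21; Rallis1984; KudlaRallis1990, §2] -/
theorem exists_forall_apply_eq_const_mul (K₀ : Subgroup G) (hK₀o : IsOpen (K₀ : Set G)) (hK₀c : IsCompact (K₀ : Set G))
    (hopen : ∀ x : X, IsOpenMap fun g : G => g • x) [IsPretransitive G X] (χ : G →* ℂ) (hχ : ∀ k ∈ K₀, χ k = 1)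
    (T₁ T₂ : (X → ℂ) →ₗ[ℂ] ℂ)
    (hT₁ : ∀ F : X → ℂ, IsLocallyConstant F → HasCompactSupport F → ∀ g : G, T₁ (fun z => F (g • z)) = χ g * T₁ F)
    (hT₂ : ∀ F : X → ℂ, IsLocallyConstant F → HasCompactSupport F → ∀ g : G, T₂ (fun z => F (g • z)) = χ g * T₂ F)
    {F₀ : X → ℂ} (hF₀ : IsLocallyConstant F₀) (hF₀s : HasCompactSupport F₀) (hne : T₁ F₀ ≠ 0) :
    ∃ c : ℂ, ∀ F : X → ℂ, IsLocallyConstant F → HasCompactSupport F → T₂ F = c * T₁ F := by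
  -- `X` is non-empty since `T₁ F₀ ≠ 0`
  rcases isEmpty_or_nonempty X with hX | ⟨⟨x₀⟩⟩
  · exfalso
    have hF0 : F₀ = 0 := funext fun x => isEmptyElim x
    exact hne (by rw [hF0, map_zero])
  have hbase : T₁ ((orbit K₀ x₀).indicator fun _ => (1 : ℂ)) ≠ 0 := fun h0 =>
    hne (eq_zero_of_apply_base_eq_zero K₀ hK₀o hK₀c hopen χ hχ x₀ T₁ hT₁ h0 hF₀ hF₀s)
  refine ⟨T₂ ((orbit K₀ x₀).indicator fun _ => (1 : ℂ)) / T₁ ((orbit K₀ x₀).indicator fun _ => (1 : ℂ)), fun F hF hFs => ?_⟩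
  have h := apply_mul_apply_base_comm K₀ hK₀o hK₀c hopen χ hχ x₀ T₁ T₂ hT₁ hT₂ hF hFs
  field_simp
  linear_combination -h

end Main

end Summit.HodgeConjecture.HodgeConjecture.Cruxes.HLiu418.K2LiuHomogeneousFunctionalLine

end
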